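import Mathlib
import Summits.Ventures.PercRepro2.Defs
import Summits.Ventures.PercRepro2.Graph
import Summits.Ventures.PercRepro2.HullDefs
import Summits.Ventures.PercRepro2.Switching
import Summits.Ventures.PercRepro2.LastVertex
import Summits.Ventures.PercRepro2.ReimerIncreasing
import Summits.Ventures.PercRepro2.ReimerDecreasing
import Summits.Ventures.PercRepro2.TwoClusterBK
import Summits.Ventures.PercRepro2.OneSidedBase
import Summits.Ventures.PercRepro2.RigidOneSided
import Summits.Ventures.PercRepro2.TypedRigidOneSided
import Summits.Ventures.PercRepro2.TypedRigidOneSidedPinned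

/-!
# The pinned typed (RO) with the blue condition `u ∈ C_B(h)` (blind cell PercRepro2, night-4 g7,
2026-08-25; proofs/NIGHT4-G7.md §7.1, §8f)

g6's `TypedRO.exists_typedRigidOneSidedB` (the `(R, b)` ingredient of the typed cut-vertex
composition: on `{C_R(u) ∈ 𝓤, h ∉ C_R(u), u ∈ C_B(h)}` every red edge inside `C_R(h)` can be flipped
by a permutation of the class) on a PINNED fibre, same-pin transition, exactly as
`TypedRigidOneSidedPinned.lean`: the extra condition `u ∈ C_B(h)` reads, on the cube of the free
edges, as `Carries ((freeE ∖ S) ∪ PB) u h` — decreasing in `S` — and Reimer on the decreasing set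
`evDBP` does the rest.  Census (pinned2.py, shape RO+B): 0 failures on all transitions at `n ≤ 6`.
-/

namespace Summit.Ventures.PercRepro2

namespace TypedROP

open Hull ReimerCube OneSided RigidOS TypedRO

open scoped Classical

variable {V : Type*} {E : Type*} [Fintype E] [DecidableEq E] (ends : E → Sym2 V)

/-- The pinned typed class with the blue condition:
`{ζ pinned : C_R(u) ∈ 𝓤, h ∉ C_R(u), u ∈ C_B(h)}`. -/
noncomputable def tClassPB (P PB : Finset E) (u h : V) (𝓤 : Set (Set V)) : Finset (Config E) :=
  Finset.univ.filter fun ζ =>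
    Pinned P PB ζ ∧ cluster ends ζ u ∈ 𝓤 ∧ h ∉ cluster ends ζ u ∧ u ∈ cluster ends (blue ζ) h

/-- `{u ↮_R h in S ∪ P} ∩ {u ↔_B h in (freeE ∖ S) ∪ PB}` on the cube of the free edges. -/
def evDBP (P PB : Finset E) (u h : V) (S : Finset E) : Prop :=
  ¬ Carries ends (S ∪ P) u h ∧ Carries ends ((freeE P PB \ S) ∪ PB) u h

/-- `evDBP` is decreasing. -/
lemma decr_evDBP (P PB : Finset E) (u h : V) : Decr (evDBP ends P PB u h) := by
  intro S T hST hT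
  refine ⟨fun hS => hT.1 (hS.mono (Finset.union_subset_union_left hST)), ?_⟩
  exact hT.2.mono (Finset.union_subset_union_left
    (Finset.sdiff_subset_sdiff (Finset.Subset.refl _) hST))

/-- **Pinned typed rigid one-sided domination with the blue condition, cube form.** -/
theorem count_le_typedRigidPB (P PB : Finset E) (u h : V) {𝓤 : Set (Set V)} (h𝓤 : IsUpperSet 𝓤)
    {𝓕 : Set (Finset E)} (h𝓕 : IsUpperSet 𝓕) :
    ((freeE P PB).powerset.filter fun S : Finset E =>
        evUP ends P u 𝓤 S ∧ evRP ends P h 𝓕 S ∧ evDBP ends P PB u h S).card ≤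
      ((freeE P PB).powerset.filter fun S : Finset E =>
        evUP ends P u 𝓤 S ∧ (freeE P PB \ S) ∈ 𝓕 ∧ evDBP ends P PB u h S).card := by
  calc ((freeE P PB).powerset.filter fun S : Finset E =>
        evUP ends P u 𝓤 S ∧ evRP ends P h 𝓕 S ∧ evDBP ends P PB u h S).card
      ≤ ((freeE P PB).powerset.filter fun S : Finset E =>
          DOcc (evUP ends P u 𝓤) (evRP ends P h 𝓕) S ∧ evDBP ends P PB u h S).card := by
        apply Finset.card_le_card
        intro S hS
        simp only [Finset.mem_filter, Finset.mem_powerset] at hS ⊢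
        obtain ⟨hSU, hAS, hJS, hDS⟩ := hS
        refine ⟨hSU, ⟨sComp ends (S ∪ P) u \ P, sComp ends (S ∪ P) h \ P,
          sComp_sdiff_subset ends P S u, sComp_sdiff_subset ends P S h,
          Finset.disjoint_of_subset_left Finset.sdiff_subset
            (Finset.disjoint_of_subset_right Finset.sdiff_subset
              (disjoint_sComp_of_not_carries hDS.1)), ?_, ?_⟩, hDS⟩
        · intro T hT
          exact h𝓤 (cluster_subset_of_sComp_subset ends u (sComp_subset_union_of ends hT)) hAS
        · intro T hT
          refine h𝓕 (Finset.sdiff_subset_sdiff ?_ le_rfl) hJS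
          exact sComp_mono_of_subset ends h (sComp_subset_union_of ends hT)
    _ ≤ ((freeE P PB).powerset.filter fun S : Finset E =>
          evUP ends P u 𝓤 S ∧ evRP ends P h 𝓕 (freeE P PB \ S) ∧ evDBP ends P PB u h S).card :=
        reimer_decreasing (freeE P PB) (evUP ends P u 𝓤) (evRP ends P h 𝓕) (evDBP ends P PB u h)
          (incr_evUP ends P u h𝓤) (incr_evRP ends P h h𝓕) (decr_evDBP ends P PB u h)
    _ ≤ _ := by
        apply Finset.card_le_card
        intro S hS
        simp only [Finset.mem_filter, Finset.mem_powerset, evRP] at hS ⊢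
        obtain ⟨hSU, hAS, hJS, hDS⟩ := hS
        exact ⟨hSU, hAS, h𝓕 (sComp_sdiff_subset ends P _ h) hJS, hDS⟩

/-- The blue cluster of `h` in `cfg P S` is the cluster in `(freeE ∖ S) ∪ PB` (for `S` free). -/
lemma blue_cfg_eq {P PB : Finset E} (hd : Disjoint P PB) {S : Finset E} (hS : S ⊆ freeE P PB) :
    blue (cfg P S) = ofFinset ((freeE P PB \ S) ∪ PB) := by
  funext e
  simp only [blue_apply, cfg, ofFinset_apply, Finset.mem_union, Finset.mem_sdiff, freeE,
    Finset.mem_univ, true_and, not_or]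
  by_cases hP : e ∈ P
  · have h1 : e ∉ PB := Finset.disjoint_left.1 hd hP
    simp [hP, h1]
  · by_cases hB : e ∈ PB
    · have h2 : e ∉ S := fun hs => by
        have := hS hs
        simp [freeE, Finset.mem_sdiff, hB] at this
      simp [hP, hB, h2]
    · by_cases hs : e ∈ S
      · simp [hP, hB, hs]
      · simp [hP, hB, hs]

/-- **Pinned typed rigid one-sided domination with the blue condition**: for every up-set `𝓕`,
`#{ζ ∈ tClassPB : hRedFree ζ ∈ 𝓕} ≤ #{ζ ∈ tClassPB : blue ζ ∈ 𝓕}`. -/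
theorem card_typedRigidPB_le {P PB : Finset E} (hd : Disjoint P PB) (u h : V) {𝓤 : Set (Set V)}
    (h𝓤 : IsUpperSet 𝓤) {𝓕 : Set (Finset E)} (h𝓕 : IsUpperSet 𝓕) :
    ((tClassPB ends P PB u h 𝓤).filter fun ζ => hRedFree ends P PB h ζ ∈ 𝓕).card ≤
      ((tClassPB ends P PB u h 𝓤).filter fun ζ => RigidOS.blueF ζ ∈ 𝓕).card := by
  have e1 : ((tClassPB ends P PB u h 𝓤).filter fun ζ => hRedFree ends P PB h ζ ∈ 𝓕) =
      Finset.univ.filter fun ζ => Pinned P PB ζ ∧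
        (cluster ends ζ u ∈ 𝓤 ∧ h ∉ cluster ends ζ u ∧ u ∈ cluster ends (blue ζ) h ∧
          hRedFree ends P PB h ζ ∈ 𝓕) := by
    rw [tClassPB, Finset.filter_filter]; congr 1; ext ζ; tauto
  have e2 : ((tClassPB ends P PB u h 𝓤).filter fun ζ => RigidOS.blueF ζ ∈ 𝓕) =
      Finset.univ.filter fun ζ => Pinned P PB ζ ∧
        (cluster ends ζ u ∈ 𝓤 ∧ h ∉ cluster ends ζ u ∧ u ∈ cluster ends (blue ζ) h ∧
          RigidOS.blueF ζ ∈ 𝓕) := by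
    rw [tClassPB, Finset.filter_filter]; congr 1; ext ζ; tauto
  rw [e1, e2, card_filter_pinned hd, card_filter_pinned hd]
  have key := count_le_typedRigidPB ends P PB u h h𝓤 h𝓕
  have hDB : ∀ S, S ⊆ freeE P PB →
      ((h ∉ cluster ends (cfg P S) u ∧ u ∈ cluster ends (blue (cfg P S)) h) ↔
        evDBP ends P PB u h S) := by
    intro S hS
    rw [blue_cfg_eq hd hS]
    simp only [evDBP, mem_cluster, Carries, cfg]
    constructor
    · rintro ⟨h1, h2⟩; exact ⟨fun hc => h1 hc, conn_symm h2⟩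
    · rintro ⟨h1, h2⟩; exact ⟨fun hc => h1 hc, conn_symm h2⟩
  calc ((freeE P PB).powerset.filter fun S : Finset E =>
          cluster ends (cfg P S) u ∈ 𝓤 ∧ h ∉ cluster ends (cfg P S) u ∧
            u ∈ cluster ends (blue (cfg P S)) h ∧ hRedFree ends P PB h (cfg P S) ∈ 𝓕).card
      = ((freeE P PB).powerset.filter fun S : Finset E =>
          evUP ends P u 𝓤 S ∧ evRP ends P h 𝓕 S ∧ evDBP ends P PB u h S).card := by
        apply congrArg Finset.card
        ext S
        simp only [Finset.mem_filter, Finset.mem_powerset]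
        constructor
        · rintro ⟨hS, hU, hh, hb, hF⟩
          refine ⟨hS, hU, ?_, (hDB S hS).1 ⟨hh, hb⟩⟩
          simpa only [evRP, hRedFree_cfg ends hd hS h] using hF
        · rintro ⟨hS, hU, hF, hD⟩
          obtain ⟨hh, hb⟩ := (hDB S hS).2 hD
          refine ⟨hS, hU, hh, hb, ?_⟩
          simpa only [evRP, hRedFree_cfg ends hd hS h] using hF
    _ ≤ ((freeE P PB).powerset.filter fun S : Finset E =>
          evUP ends P u 𝓤 S ∧ (freeE P PB \ S) ∈ 𝓕 ∧ evDBP ends P PB u h S).card := key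
    _ ≤ _ := by
        apply Finset.card_le_card
        intro S hS
        simp only [Finset.mem_filter, Finset.mem_powerset] at hS ⊢
        obtain ⟨hS, hU, hF, hD⟩ := hS
        obtain ⟨hh, hb⟩ := (hDB S hS).2 hD
        refine ⟨hS, hU, hh, hb, h𝓕 ?_ hF⟩
        intro e he
        rw [Finset.mem_sdiff] at he
        rw [RigidOS.mem_blueF]
        simp only [cfg, ofFinset_apply, decide_eq_false_iff_not, Finset.mem_union, not_or]
        have := he.1
        simp only [freeE, Finset.mem_sdiff, Finset.mem_univ, true_and, Finset.mem_union,
          not_or] at this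
        exact ⟨he.2, this.1⟩

/-- **The pinned typed rigid one-sided permutation with the blue condition** (Hall). -/
theorem exists_typedRigidOneSidedPinnedB {P PB : Finset E} (hd : Disjoint P PB) (u h : V)
    {𝓤 : Set (Set V)} (h𝓤 : IsUpperSet 𝓤) :
    ∃ f : {ζ // ζ ∈ tClassPB ends P PB u h 𝓤} → Config E, Function.Injective f ∧
      ∀ x, f x ∈ tClassPB ends P PB u h 𝓤 ∧
        ∀ e, e ∈ within ends (cluster ends x.1 h) → x.1 e = true → e ∉ P ∪ PB → f x e = false := by
  let D := tClassPB ends P PB u h 𝓤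
  let R : Config E → Finset E := hRedFree ends P PB h
  let t : {ζ // ζ ∈ D} → Finset (Config E) := fun x => D.filter fun η => ∀ e ∈ R x.1, η e = false
  have hall : ∀ s : Finset {ζ // ζ ∈ D}, s.card ≤ (s.biUnion t).card := by
    intro s
    obtain ⟨𝓕, h𝓕, h𝓕mem⟩ : ∃ 𝓕 : Set (Finset E), IsUpperSet 𝓕 ∧ ∀ F, F ∈ 𝓕 ↔ ∃ x ∈ s, R x.1 ⊆ F :=
      ⟨{F | ∃ x ∈ s, R x.1 ⊆ F}, fun F F' hFF' ⟨x, hx, hxF⟩ => ⟨x, hx, hxF.trans hFF'⟩,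
        fun F => Iff.rfl⟩
    have e1 : s.biUnion t = D.filter fun η => RigidOS.blueF η ∈ 𝓕 := by
      ext η
      simp only [Finset.mem_biUnion, Finset.mem_filter, t, h𝓕mem]
      constructor
      · rintro ⟨x, hx, hη, hsub⟩
        exact ⟨hη, x, hx, fun e he => RigidOS.mem_blueF.2 (hsub e he)⟩
      · rintro ⟨hη, x, hx, hsub⟩
        exact ⟨x, hx, hη, fun e he => RigidOS.mem_blueF.1 (hsub he)⟩
    have e2 : s.card ≤ (D.filter fun ζ => R ζ ∈ 𝓕).card := by
      refine Finset.card_le_card_of_injOn (fun x => x.1) ?_ ?_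
      · intro x hx
        rw [Finset.mem_coe] at hx
        simp only [Finset.mem_coe, Finset.mem_filter, h𝓕mem]
        exact ⟨x.2, x, hx, le_rfl⟩
      · intro x _ y _ hxy
        exact Subtype.ext hxy
    calc s.card ≤ (D.filter fun ζ => R ζ ∈ 𝓕).card := e2
      _ ≤ (D.filter fun ζ => RigidOS.blueF ζ ∈ 𝓕).card := card_typedRigidPB_le ends hd u h h𝓤 h𝓕
      _ = (s.biUnion t).card := by rw [e1]
  obtain ⟨f, hf, hft⟩ := (Finset.all_card_le_biUnion_card_iff_exists_injective t).1 hall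
  refine ⟨f, hf, fun x => ?_⟩
  have := hft x
  simp only [t, Finset.mem_filter] at this
  exact ⟨this.1, fun e he hred hfree => this.2 e (mem_hRedFree_of ends he hred hfree)⟩

end TypedROP

end Summit.Ventures.PercRepro2
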